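import Literature.MathematicalPhysics.QuantumFieldTheory.Balaban1983to89.B6SectAWholeTorusBridge
import Literature.MathematicalPhysics.QuantumFieldTheory.Balaban1983to89.B6Eq217ScalarModelV1
import Literature.MathematicalPhysics.QuantumFieldTheory.Balaban1983to89.B6Eq28LandauGaugeV1

/-!
# `Balaban1983to89.B5Eq144ProjV1` — T. Bałaban, *Propagators and renormalization transformations for lattice gauge theories. I*,
# Commun. Math. Phys. **95** (1984) 17–40 [Balaban1984PropagatorsI], Sect. C p. 25, (1.42)–(1.44): `Δ′_a = Δ + aQ′_k*Q′_k`, the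
# minimizing function `λ₀ = G′_k∂*A − G′_k²Q′_k*(Q′_kG′_k²Q′_k*)⁻¹Q′_kG′_k∂*A` (1.43) and the projection `R` (1.44) — ON THE V1 LATTICE
# CALCULUS, as the whole-torus case `Ω₁ = … = Ω_k = T_η` of T. Bałaban, *… II*, CMP **96** (1984) [Balaban1984PropagatorsII] (2.13)–(2.17)
# (p21's CONSTRUCTED `Δ′_a`, `G′`, `(Q′G′²Q′*)⁻¹`, `λ` of (2.16), (2.17) `R = I − G′Q′*(Q′G′²Q′*)⁻¹Q′G′` for every nested family,
# `B6SectAScalarModelV1`/`B6Eq217ScalarModelV1`) through this seat's `B6SectAWholeTorusBridge` (`RE_whole_eq`: p21's `R` at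
# `Domains.whole k` = p11's `projR` of (1.47)/(4.4.1)); companion file 4 of the whole-torus knitting

statement-level skeleton of published theorems with citation tags; proofs where landed; nothing here is a claim about the
Yang–Mills mass gap

PDF held: `paper:balaban1984-cmp95-propagators-rt-i` (journal page = PDF page + 16; p. 25 [PDF 9] read from the materialised text
`~/.lit/texts/paper-balaban1984-cmp95-propagators-rt-i/p0009.txt`, this seat, 2026-08-21; the display (1.44) itself is lost in the text
layer — its content is taken from [B6] (2.17), which [B6] p. 224 declares to be the generalization of [B5] Sects. C–D);
`paper:balaban1984-cmp96-propagators-rt-ii` (journal page = PDF page + 222; p. 225 [PDF 3]).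

PRINT, verbatim.  [B5] p. 25: «Let us sketch briefly another possible approach to the calculation of the integral (1.23). We write
(1.24) = ∫dλ δ(Q′_kλ) exp(−(1/2α)‖∂*A − Δλ − aQ′_k*Q′_kλ‖²), (1.42) with a > 0 (we will take eventually a = 1), and let us denote
Δ′_a = Δ + aQ′_k*Q′_k = Δ + aP′_k. The properties of this operator were investigated in [2], its inverse is a bounded operator G′_k with
good regularity properties described in Theorem of [2]. We repeat the calculations done after the formula (1.24) with the operator Δ′_a
instead of Δ and we get the following formulas for the minimizing function λ₀, λ₀ = G′_k∂*A − G′_k²Q′_k*(Q′_kG′_k²Q′_k*)⁻¹Q′_kG′_k∂*A, (1.43)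
and for the projection operator R … (1.44) Now all the operators appearing in these formulas are well defined. We have to verify it only
for (Q′_kG′_k²Q′_k*)⁻¹. It is enough to prove that Q′_kG′_k²Q′_k* is positive definite.»; p. 25 top: «The projection operator R has a
clear meaning. It is an orthogonal projection on the linear subspace ΔN(Q′_k) of L²(T_η), N(Q′_k) = {λ : Q′_kλ = 0}. Indeed RΔλ = Δλ if
Q′_kλ = 0».  [B6] p. 225: «λ = G′f − G′²Q′*(Q′G′²Q′*)⁻¹Q′G′f. (2.16) Of course Q′λ = 0 and we have Rf = Δλ = Δ′_aλ = (I − G′Q′*(Q′G′²Q′*)⁻¹Q′G′)f.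
(2.17)».

CITATION HEADER (lean-in-tree rule) — WHAT IS REPRODUCED.  Phase-2 file of the `lit-balaban` typed skeleton (HOME
`run/shared/lean/pub/lit-balaban/`), seat **p16 gen 5** (owners r02 (B5 rows B5.Eq1.44 = (1.42)–(1.44), B5.Eq1.47), r03 (B6.Eq2.13 /
B6.Eq2.17), r18 (X05 = B5.Eq2.8-1.27), referee ref-4): V1 INSTANCES of SKELETON row **B5.Eq1.44** (decls of record on the torus:
`B5Projector144.R144`/`lambda0`, `B5Projector144Exists`, `B5QGGQ145Torus.qggq_definite` — untouched) as the whole-torus case of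
**B6.Eq2.13** / **B6.Eq2.17** (p21's `B6SectAScalarModelV1.deltaPE`/`GpE`/`CpE`, `B6Eq217ScalarModelV1.lam216`/`eq217_op_V1`/
`RE_eq_lapE_lam216`/`lam216_mem_ker` — untouched), with `R`, `∂*`, `Δ`, `Q′_k` = p11's `opsV1 P k c s` fields (`projR`, `dstar`, `lap`, `Qp`),
the Landau subspace `lan` (p38) and r18's one-level `IsLandauGauge` (gen 4's `B6Eq28LandauGaugeV1.isLandauGauge_iff_mem_lan`).  THEOREMS ONLY:
no definition, no `def … : Prop`, nothing is a named unproved fact.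

WHAT IS PROVED (kernel, no `sorry`, standard axioms; `k ≤ m + K`, `c ≠ 0`, `s ≠ 0` where stated, every `a = w > 0`, every `d ≥ 1`):
* §1 `inner_deltaPE_whole` — (1.42) `Δ′_a = Δ + aQ′_k*Q′_k` at the whole torus as a form in p11's vocabulary (`⟨f, Δ′_af⟩ = s⁻¹⟨f, Δf⟩ +
  Σ a|(Q′f)(y)|²`), `QpE_whole_apply` (every index `y ∈ 𝔅` is a `k`-block, `(Q′f)(y) = (Q′_kf)(y)`).
* §2 **`projR_eq_repr217_whole`** / `projR_apply_eq_repr217_whole` — **(1.44) ON V1**: p11's `projR` (the `R` of (1.47)/(4.4.1), *"an orthogonal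
  projection on the linear subspace ΔN(Q′_k)"*) `= I − G′_kQ′_k*(Q′_kG′_k²Q′_k*)⁻¹Q′_kG′_k` (r03's `B6SectA.repr217` of p21's whole-torus `GpE`,
  `CpE`), every `a > 0`.
* §3 **`eq143_whole`** — **(1.43) ON V1**: `λ₀ := λ(2.16)(∂*A)` satisfies `Q′_kλ₀ = 0` and `R∂*A = Δλ₀` for p11's `R`, `∂*`, `Δ`;
  **`sub_gradV1_lam216_mem_lan`**: `A − ∂λ₀ ∈ {R∂*A = 0}` — the (1.43) `λ₀` IS the Landau gauge function of (1.47) (the explicit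
  representative of `B6SectAWholeTorusBridge.existsUnique_landauGauge`), and `landauGauge_eq_lam216` (conversely the unique one IS `λ₀`,
  for every `a > 0`).
* §4 `isLandauGauge_iff_RE_whole_one` — r18's one-level (2.9)/(2.12) `IsLandauGauge c A` ⟺ p21's `R∂*A = 0` at `Domains.whole 1` (three
  typings of the one-level Landau gauge agree: r18 / p38 `lan P 1` / p21).

READINGS / HONEST SCOPE.  (a) U = 1 real fields; `Λ₀ = ∅`.  (b) (1.44)'s display is OCR-lost; the formula proved is [B6] (2.17)'s
`I − G′Q′*(Q′G′²Q′*)⁻¹Q′G′`, which [B6] states as the generalization of the (1.43)/(1.44) pair, with the (1.43) `λ₀` reproduced verbatim by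
p21's `lam216`.  (c) p11's `Δ = s·laplace c` versus p21's `lapE c` (no weight) gives the factor `s⁻¹`/`s` bookkeeping; the subspace
`ΔN(Q′_k)`, `R`, `λ₀` and the Landau gauge do not depend on `s ≠ 0`.  (d) The positivity of `Q′_kG′_k²Q′_k*` and the bounds
`0 < Q′_kG′_k²Q′_k* ≤ a⁻²` ((1.45)) are p21's `qggqpE_injective` / r02's torus files — not restated.  GAPS.md: nothing.
-/

open scoped InnerProductSpace

namespace Literature.MathematicalPhysics.QuantumFieldTheory.Balaban1983to89.B5Eq144ProjV1

open LatticeFieldCalculus B6SectADomainsV1 B6SectAOperatorsV1 B6SectAScalarModelV1 B6Eq217ScalarModelV1 B6SectAWholeTorusBridge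
open BalabanImbrieJaffe1984to88.BIJ85AxialPropagator411 (BondSpace)
open BalabanImbrieJaffe1984to88.BIJ85LandauForm441 (LandauOps)
open BalabanImbrieJaffe1984to88.BIJ85LandauMinimizer442V1 (opsV1 gradV1 opsV1_Qp opsV1_lap)

noncomputable section

variable {P : Params} {k : ℕ} (hk : k ≤ P.m + P.K) {c s : ℝ}

/-! ## §1. (1.42): `Δ′_a = Δ + aQ′_k*Q′_k` on V1 IS p21's `Δ′_a` (2.13) at the whole torus -/

/-- **(1.42) `Δ′_a = Δ + aQ′_k*Q′_k`** as a quadratic form on `L²(T_η)`: p21's (2.13) `Δ′_a = Δ + Q′*aQ′` at the whole torus reads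
`⟨f, Δ′_af⟩ = s⁻¹·⟨f, (opsV1 P k c s).lap f⟩ + Σ_{y ∈ 𝔅} a(y)|(Q′f)(y)|²`, every `y ∈ 𝔅` sitting at the top level `k` with
`(Q′f)(y) = (Q′_kf)(y)` (`siteAvgIter k`). [cite: Balaban1984PropagatorsI, (1.42) p.25] -/
theorem inner_deltaPE_whole (hs : s ≠ 0) (w : SiteIdx (Domains.whole (P := P) k hk) → ℝ) (f : ScalarSpace P) :
    ⟪f, deltaPE (Domains.whole (P := P) k hk) c w f⟫_ℝ =
      s⁻¹ * ⟪f, (opsV1 P k c s).lap f⟫_ℝ + ∑ i, w i * QpE (Domains.whole (P := P) k hk) f i ^ 2 := by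
  rw [inner_deltaPE_self, lap_opsV1_eq_smul_lapE, LinearMap.smul_apply, inner_smul_right, inner_lapE_right,
    real_inner_self_eq_norm_sq]
  field_simp

/-- every index of the site part of `𝔅` sits at the top level `k`: `(Q′f)(y) = (Q′_kf)(y)`. [cite: Balaban1984PropagatorsI, (1.42) p.25] -/
theorem QpE_whole_apply (f : ScalarSpace P) (i : SiteIdx (Domains.whole (P := P) k hk)) :
    QpE (Domains.whole (P := P) k hk) f i = siteAvgIter (i.1.1 : ℕ) (WithLp.ofLp f) i.1.2 ∧ (i.1.1 : ℕ) = k :=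
  ⟨rfl, (lamSite_whole_iff hk i.1.2).mp i.2⟩

/-! ## §2. (1.44): `R` of (1.47)/(4.4.1) (p11's `projR`) = `I − G′_kQ′_k*(Q′_kG′_k²Q′_k*)⁻¹Q′_kG′_k` (p21's (2.17) at the whole torus) -/

/-- **(1.44) ON V1**: the orthogonal projection `R` onto `ΔN(Q′_k)` of [B5] p. 25 / (1.47) (p11's `(opsV1 P k c s).projR`) EQUALS the
(2.17)/(1.44) formula `I − G′Q′*(Q′G′²Q′*)⁻¹Q′G′` built from p21's CONSTRUCTED `G′_k = (Δ + aQ′_k*Q′_k)⁻¹` (`GpE`) and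
`(Q′_kG′_k²Q′_k*)⁻¹` (`CpE`) at the whole torus — every `a > 0`, `c, s ≠ 0` (*"Now all the operators appearing in these formulas are
well defined"*, p. 25). [cite: Balaban1984PropagatorsI, (1.44) p.25] -/
theorem projR_eq_repr217_whole (hc : c ≠ 0) (hs : s ≠ 0) {w : SiteIdx (Domains.whole (P := P) k hk) → ℝ} (hw : ∀ i, 0 < w i) :
    ((opsV1 P k c s).projR : ScalarSpace P →L[ℝ] ScalarSpace P).toLinearMap =
      B6SectA.repr217 (GpE (Domains.whole (P := P) k hk) hc hw) (QpE (Domains.whole (P := P) k hk))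
        (QpsE (Domains.whole (P := P) k hk)) (CpE (Domains.whole (P := P) k hk) hc hw) := by
  rw [← RE_whole_eq hk c hs, eq217_op_V1 _ hc hw]

/-- pointwise. [cite: Balaban1984PropagatorsI, (1.44) p.25] -/
theorem projR_apply_eq_repr217_whole (hc : c ≠ 0) (hs : s ≠ 0) {w : SiteIdx (Domains.whole (P := P) k hk) → ℝ} (hw : ∀ i, 0 < w i)
    (f : ScalarSpace P) :
    (opsV1 P k c s).projR f =
      B6SectA.repr217 (GpE (Domains.whole (P := P) k hk) hc hw) (QpE (Domains.whole (P := P) k hk))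
        (QpsE (Domains.whole (P := P) k hk)) (CpE (Domains.whole (P := P) k hk) hc hw) f := by
  rw [← RE_whole_apply hk c hs, eq217_V1 _ hc hw]

/-! ## §3. (1.43): `λ₀ = G′_k∂*A − G′_k²Q′_k*(Q′_kG′_k²Q′_k*)⁻¹Q′_kG′_k∂*A` IS the Landau gauge function of (1.47): `R∂*A = Δλ₀`,
`Q′_kλ₀ = 0`, `R∂*(A − ∂λ₀) = 0` -/

/-- **(1.43) on V1**: with p21's `λ` of the chain (2.16) at `f = ∂*A` (`lam216`, the printed formula) and the whole-torus family:
`Q′_kλ₀ = 0` and **`R∂*A = Δλ₀`** for p11's operators (`R = projR`, `∂* = dstar`, `Δ = lap` of `opsV1 P k c s`), every `a > 0`.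
[cite: Balaban1984PropagatorsI, (1.43) p.25] -/
theorem eq143_whole (hc : c ≠ 0) (hs : s ≠ 0) {w : SiteIdx (Domains.whole (P := P) k hk) → ℝ} (hw : ∀ i, 0 < w i)
    (x : BondSpace P) :
    (opsV1 P k c s).Qp (lam216 (Domains.whole (P := P) k hk) hc hw (dsE c x)) = 0 ∧
      (opsV1 P k c s).projR ((opsV1 P k c s).dstar x) =
        (opsV1 P k c s).lap (lam216 (Domains.whole (P := P) k hk) hc hw (dsE c x)) := by
  refine ⟨?_, ?_⟩
  · rw [opsV1_Qp, ← mem_ker_QpE_whole_iff hk]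
    exact lam216_mem_ker _ hc hw _
  · rw [dstar_opsV1_eq_smul_dsE, lap_opsV1_eq_smul_lapE, LinearMap.smul_apply, LinearMap.smul_apply, map_smul,
      ← RE_whole_apply hk c hs, (RE_eq_lapE_lam216 _ hc hw (dsE c x)).1]

/-- **`λ₀` of (1.43) IS the Landau gauge function of (1.47)**: `A − ∂λ₀ ∈ {R∂*A = 0}` (p38's `lan P k c s`) with `Q′_kλ₀ = 0` — the EXPLICIT
representative of this seat's `B6SectAWholeTorusBridge.existsUnique_landauGauge`. [cite: Balaban1984PropagatorsI, (1.43) p.25 + (1.47) p.26] -/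
theorem sub_gradV1_lam216_mem_lan (hc : c ≠ 0) (hs : s ≠ 0) {w : SiteIdx (Domains.whole (P := P) k hk) → ℝ} (hw : ∀ i, 0 < w i)
    (x : BondSpace P) :
    siteAvgIter k (WithLp.ofLp (lam216 (Domains.whole (P := P) k hk) hc hw (dsE c x))) = 0 ∧
      x - gradV1 P c (lam216 (Domains.whole (P := P) k hk) hc hw (dsE c x)) ∈ B5Eq164LandauV1.lan P k c s := by
  have hmem := lam216_mem_ker (Domains.whole (P := P) k hk) hc hw (dsE c x)
  refine ⟨(mem_ker_QpE_whole_iff hk _).mp hmem, ?_⟩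
  rw [← RE_dsE_whole_eq_zero_iff_mem_lan hk c hs, ← dE_eq_gradV1, map_sub, map_sub,
    show dsE c (dE c _) = lapE c _ from rfl, RE_eq_self _ c (Submodule.mem_map_of_mem hmem),
    (RE_eq_lapE_lam216 _ hc hw (dsE c x)).1, sub_self]

/-- hence the unique Landau gauge function of `existsUnique_landauGauge` IS `λ₀` of (1.43) (every `a > 0` gives the same `λ₀`).
[cite: Balaban1984PropagatorsI, (1.43) p.25 + (1.47) p.26] -/
theorem landauGauge_eq_lam216 (hc : c ≠ 0) (hs : s ≠ 0) {w : SiteIdx (Domains.whole (P := P) k hk) → ℝ} (hw : ∀ i, 0 < w i)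
    (x : BondSpace P) {n : ScalarSpace P} (hn : siteAvgIter k (WithLp.ofLp n) = 0)
    (hlan : x - gradV1 P c n ∈ B5Eq164LandauV1.lan P k c s) :
    n = lam216 (Domains.whole (P := P) k hk) hc hw (dsE c x) :=
  (existsUnique_landauGauge hk hc hs x).unique ⟨hn, hlan⟩ (sub_gradV1_lam216_mem_lan hk hc hs hw x)

/-! ## §4. One level: r18's (2.9)/(2.12) `IsLandauGauge` IS p21's (2.12) at `Domains.whole 1` -/

/-- **three typings of the one-level Landau gauge agree**: r18's `LatticeFieldCalculus.IsLandauGauge c A` ([B6] (2.9)/(2.12) one level,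
gen 4), p38's `lan P 1 c′ s′` ([B5] (1.47), via gen 4's `isLandauGauge_iff_mem_lan`) and p21's multi-scale `R∂*A = 0` at the whole-torus
family of depth `1`. [cite: Balaban1984PropagatorsII, (2.12) p.225] -/
theorem isLandauGauge_iff_RE_whole_one (h1 : 1 ≤ P.m + P.K) {c c' s' : ℝ} (hc : c ≠ 0) (hc' : c' ≠ 0) (hs' : s' ≠ 0)
    (A : VecField P 0 ℝ) :
    IsLandauGauge c A ↔ RE (Domains.whole (P := P) 1 h1) c' (dsE c' (WithLp.toLp 2 A)) = 0 := by
  rw [B6Eq28LandauGaugeV1.isLandauGauge_iff_mem_lan hc hc' hs' A, RE_dsE_whole_eq_zero_iff_mem_lan h1 c' hs']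

end

end Literature.MathematicalPhysics.QuantumFieldTheory.Balaban1983to89.B5Eq144ProjV1
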